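import Summits.Ventures.LatticeQCDFlow.Exactness.AcceptanceFromMeanEnergyViolationSharp
import Summits.Ventures.LatticeQCDFlow.Exactness.AcceptanceFromMeanEnergyViolationTwoState
import HarnessLib

/-!
HONEST FRAMING: exact (Metropolis-corrected) sampling algorithms for lattice gauge theory; figures
of merit are autocorrelation/cost numbers at stated couplings and volumes; no continuum-physics
claim.

# AcceptanceFromMeanAbsViolationSharp — THE FERMI-FUNCTION FLOOR: A VOLUME-PRESERVING REVERSIBLE PROPOSAL WITH
# MEAN ABSOLUTE ENERGY VIOLATION `ℓ = ⟨|ΔH|⟩` ACCEPTS AT LEAST `2/(1 + e^{ℓ}) = 1 − tanh(ℓ/2)` OF THE TIME, AND THE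
# TWO-STATE FLIP ATTAINS IT (row 22 `su3-ptbc`, GEN-10, ours; companion of `AcceptanceFromMeanEnergyViolationSharp`)

Venture `LatticeQCDFlow` (cell pub-lqcd), topic `Exactness`; FANOUT row 22 (`su3-ptbc`).  NEW WORK of the cell in row 2's
framework `Phi4HMCFluctuationRelation`, over this seat's `AcceptanceFromMeanEnergyViolationSharp` (`integral_posPart_weights_le`)
and `…TwoState` (the two-state numbers).  Nothing is cited as a fact; no numerics.

THE POINT.  The companion file floors the acceptance by the signed mean `⟨ΔH⟩`; lean-2's Jensen floor
`swapAcc ≥ exp(−⟨|ΔS|⟩)` (`SwapAcceptanceLaw.swapAcc_ge_exp_neg`) uses the ABSOLUTE mean `ℓ = ⟨|ΔH|⟩`.  In that statistic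
the extremal problem is in closed form: by the fluctuation relation `1 − A/Z = ∫ tanh(x/2) dσ`, `ℓ = ∫ x dσ` for the
sub-probability `σ = (1 + e^{−x})·(law of ΔH on x > 0)`, and `tanh(x/2)` is CONCAVE on `[0, ∞)`, so each tangent is a
certificate: `1 − A/Z ≤ tanh(a/2) + ½sech²(a/2)(ℓ − a) = (e^{2a} − 1 + 2e^{a}(ℓ − a))/(e^{a} + 1)²` (`a > 0`), with
envelope **`A/Z ≥ 2/(1 + e^{ℓ})`** at `a = ℓ` — the Fermi function of the mean absolute violation; the two-state flip of
gap `a` has `⟨|ΔH|⟩ = a` and rate exactly `2/(1 + e^{a})`, so the floor is attained at EVERY `ℓ`.  It strictly improves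
the Jensen floor `e^{−ℓ}` by the factor `2e^{ℓ}/(1 + e^{ℓ}) ∈ (1, 2)`.

## What is proved

* §1 `fermiCert_nonneg` — for `a > 0`, `x ≥ 0`:
  `(1 − e^{−x})(e^{a} + 1)² ≤ (1 + e^{−x})((e^{2a} − 1) + 2e^{a}(x − a))` (convex in `x` since `e^{a} ≥ 1 + a`, double zero
  at `x = a`);
  `one_sub_min_exp_neg_mul_fermi_le` — the integrand form for every real `d`.
* §2 `integral_posPart_absMoment_eq` (`∫ ΔH(1 + e^{−ΔH})𝟙[ΔH>0] e^{−H} = ∫ |ΔH| e^{−H}`),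
  **`involutive_acceptance_ge_fermiPencil`** (every `a > 0`:
  `(1 − (e^{2a} − 1 + 2e^{a}(ℓ − a))/(e^{a} + 1)²)·Z ≤ A`, `ℓ = Z⁻¹∫|ΔH|e^{−H}`) and
  **`involutive_acceptance_ge_fermi`** (`ℓ > 0 ⇒ (2/(1 + e^{ℓ}))·Z ≤ A`).
* §3 **`twoState_meanAbsViolation`** (`ℓ = a` for the flip) and **`twoState_attains_fermi`** (`(2/(1 + e^{a}))·Z = A`).

Literature grade: elementary; NEW TYPING (sharp constant).  NOT CLAIMED: anything about a run; a ceiling (none exists).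
-/

namespace Summit.Ventures.LatticeQCDFlow.Exactness

open Real MeasureTheory Filter Set

/-! ## §1 The tangent certificate of the concave profile `tanh(x/2)` -/

section Certificate

/-- **THE CERTIFICATE**: for `a > 0` and `x ≥ 0`,
`(1 − e^{−x})(e^{a} + 1)² ≤ (1 + e^{−x})((e^{2a} − 1) + 2e^{a}(x − a))` — the tangent of the concave `tanh(x/2)` at `a`
(the difference is convex in `x` with a double zero at `x = a`). [ours] -/
theorem fermiCert_nonneg {a : ℝ} (ha : 0 < a) {x : ℝ} (hx : 0 ≤ x) :
    (1 - Real.exp (-x)) * (Real.exp a + 1) ^ 2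
      ≤ (1 + Real.exp (-x)) * ((Real.exp (2 * a) - 1) + 2 * Real.exp a * (x - a)) := by
  set u := Real.exp a with hu
  have hu2 : Real.exp (2 * a) = u * u := by rw [hu, ← Real.exp_add]; ring_nf
  rw [hu2]
  have hua : Real.exp a * Real.exp (-a) = 1 := by rw [← Real.exp_add, add_neg_cancel, Real.exp_zero]
  have hu1 : 1 + a ≤ u := by rw [hu]; linarith [Real.add_one_le_exp a]
  -- `F(x) = (1 + e^{−x})((u² − 1) + 2u(x − a)) − (1 − e^{−x})(u + 1)²`
  set F : ℝ → ℝ := fun x => (1 + Real.exp (-x)) * ((u * u - 1) + 2 * u * (x - a))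
    - (1 - Real.exp (-x)) * (u + 1) ^ 2 with hF
  set F' : ℝ → ℝ := fun x => 2 * u * (1 - Real.exp (-x) * (u + x - a)) with hF'
  have hFd : ∀ x, HasDerivAt F (F' x) x := by
    intro x
    have he : HasDerivAt (fun x => Real.exp (-x)) (-Real.exp (-x)) x := by
      simpa using (hasDerivAt_neg x).exp
    have h1 : HasDerivAt (fun x => (1 + Real.exp (-x)) * ((u * u - 1) + 2 * u * (x - a)))
        (-Real.exp (-x) * ((u * u - 1) + 2 * u * (x - a)) + (1 + Real.exp (-x)) * (2 * u * 1)) x :=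
      (he.const_add 1).mul (((hasDerivAt_id x).sub_const a).const_mul (2 * u) |>.const_add (u * u - 1))
    have h2 : HasDerivAt (fun x => (1 - Real.exp (-x)) * (u + 1) ^ 2) (-(-Real.exp (-x)) * (u + 1) ^ 2) x :=
      (he.const_sub 1).mul_const _
    refine (h1.sub h2).congr_deriv ?_
    simp only [hF']
    ring
  have hF'd : ∀ x, HasDerivAt F' (2 * u * (Real.exp (-x) * (u + x - a - 1))) x := by
    intro x
    have he : HasDerivAt (fun x => Real.exp (-x)) (-Real.exp (-x)) x := by
      simpa using (hasDerivAt_neg x).exp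
    have h1 : HasDerivAt (fun x => Real.exp (-x) * (u + x - a))
        (-Real.exp (-x) * (u + x - a) + Real.exp (-x) * 1) x :=
      he.mul (((hasDerivAt_id x).const_add u).sub_const a)
    have h2 := (h1.const_sub 1).const_mul (2 * u)
    refine h2.congr_deriv ?_
    ring
  -- `F'' ≥ 0` on `[0, ∞)` since `u ≥ 1 + a`
  have hF'mono : MonotoneOn F' (Ici 0) := by
    refine monotoneOn_of_hasDerivWithinAt_nonneg (convex_Ici 0)
      (fun x _ => (hF'd x).continuousAt.continuousWithinAt) (fun x _ => (hF'd x).hasDerivWithinAt) ?_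
    intro x hx
    rw [interior_Ici] at hx
    have hx' : 0 < x := hx
    have hpos : 0 ≤ u + x - a - 1 := by linarith
    have hu0 : 0 < u := Real.exp_pos a
    exact mul_nonneg (by linarith) (mul_nonneg (Real.exp_pos _).le hpos)
  have hF'a : F' a = 0 := by
    simp only [hF']
    rw [show u + a - a = u by ring, hu, mul_comm (Real.exp (-a)), hua]
    ring
  -- `F` decreasing on `[0, a]`, increasing on `[a, ∞)`
  have hanti : AntitoneOn F (Icc 0 a) := by
    refine antitoneOn_of_hasDerivWithinAt_nonpos (convex_Icc 0 a)
      (fun x _ => (hFd x).continuousAt.continuousWithinAt) (fun x _ => (hFd x).hasDerivWithinAt) ?_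
    intro x hx
    rw [interior_Icc] at hx
    have h := hF'mono (mem_Ici.mpr hx.1.le) (mem_Ici.mpr ha.le) hx.2.le
    rw [hF'a] at h
    exact h
  have hmono : MonotoneOn F (Ici a) := by
    refine monotoneOn_of_hasDerivWithinAt_nonneg (convex_Ici a)
      (fun x _ => (hFd x).continuousAt.continuousWithinAt) (fun x _ => (hFd x).hasDerivWithinAt) ?_
    intro x hx
    rw [interior_Ici] at hx
    have hx' : a < x := hx
    have h := hF'mono (mem_Ici.mpr ha.le) (mem_Ici.mpr (by linarith)) hx'.le
    rw [hF'a] at h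
    exact h
  have hFa : F a = 0 := by
    simp only [hF]
    have e1 : Real.exp (-a) = 1 / u := by
      rw [hu, eq_div_iff (Real.exp_pos a).ne', mul_comm]; exact hua
    rw [e1, sub_self, mul_zero, add_zero]
    have hu0 : u ≠ 0 := (Real.exp_pos a).ne'
    field_simp
    ring
  have key : 0 ≤ F x := by
    rcases le_or_gt x a with hxa | hxa
    · have h := hanti ⟨hx, hxa⟩ ⟨ha.le, le_rfl⟩ hxa
      rw [hFa] at h
      exact h
    · have h := hmono (self_mem_Ici (a := a)) (mem_Ici.mpr hxa.le) hxa.le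
      rw [hFa] at h
      exact h
  have e : F x = (1 + Real.exp (-x)) * ((u * u - 1) + 2 * u * (x - a)) - (1 - Real.exp (-x)) * (u + 1) ^ 2 := rfl
  linarith [key, e]

/-- **THE INTEGRAND FORM** of the certificate, for every real `d` and `a > 0`. [ours] -/
theorem one_sub_min_exp_neg_mul_fermi_le {a : ℝ} (ha : 0 < a) (d : ℝ) :
    (1 - min 1 (Real.exp (-d))) * (Real.exp a + 1) ^ 2
      ≤ ((Real.exp (2 * a) - 1) + 2 * Real.exp a * (d - a))
        * ((1 + Real.exp (-d)) * (if 0 < d then (1 : ℝ) else 0)) := by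
  by_cases hd : 0 < d
  · have h1 : Real.exp (-d) ≤ 1 := by
      rw [← Real.exp_zero]; exact Real.exp_le_exp.mpr (by linarith)
    rw [min_eq_right h1, if_pos hd, mul_one]
    have h := fermiCert_nonneg ha hd.le
    linarith [h]
  · have h1 : 1 ≤ Real.exp (-d) := by
      rw [← Real.exp_zero]; exact Real.exp_le_exp.mpr (by linarith)
    rw [min_eq_left h1, if_neg hd]
    simp

end Certificate

/-! ## §2 The Fermi-function floor -/

section Involutive

variable {X : Type*} [MeasurableSpace X] {μ : Measure X}

/-- **`∫ ΔH(1 + e^{−ΔH})𝟙[ΔH > 0] e^{−H} = ∫ |ΔH| e^{−H}`** (fluctuation relation with `g(x) = |x|𝟙[x < 0]`). [ours] -/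
theorem integral_posPart_absMoment_eq {H : X → ℝ} {Ψ : X → X} (hH : Measurable H) (hΨm : Measurable Ψ)
    (hΨi : Function.Involutive Ψ) (hΨμ : MeasurePreserving Ψ μ μ)
    (hΔ : Integrable (fun z => deltaH H Ψ z * Real.exp (-H z)) μ) :
    ∫ z, deltaH H Ψ z * (1 + Real.exp (-deltaH H Ψ z)) * (if 0 < deltaH H Ψ z then (1 : ℝ) else 0)
        * Real.exp (-H z) ∂μ
      = ∫ z, |deltaH H Ψ z| * Real.exp (-H z) ∂μ := by
  have hΔm : Measurable (deltaH H Ψ) := measurable_deltaH hH hΨm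
  have hwm : Measurable fun z => Real.exp (-H z) := Real.measurable_exp.comp hH.neg
  have hw0 : ∀ z, 0 ≤ Real.exp (-H z) := fun z => (Real.exp_pos _).le
  have hpos_m : Measurable fun z => (if 0 < deltaH H Ψ z then (1 : ℝ) else 0) :=
    Measurable.ite (measurableSet_lt measurable_const hΔm) measurable_const measurable_const
  have hneg_m : Measurable fun z => if deltaH H Ψ z < 0 then (1 : ℝ) else 0 :=
    Measurable.ite (measurableSet_lt hΔm measurable_const) measurable_const measurable_const
  have hdom : ∀ (φ : X → ℝ), Measurable φ → (∀ z, |φ z| ≤ 1) →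
      Integrable (fun z => deltaH H Ψ z * φ z * Real.exp (-H z)) μ := by
    intro φ hφm hφb
    refine Integrable.mono' hΔ.norm ((hΔm.mul hφm).mul hwm).aestronglyMeasurable
      (Eventually.of_forall fun z => ?_)
    rw [Real.norm_eq_abs, Real.norm_eq_abs, abs_mul, abs_mul, abs_mul, abs_of_nonneg (hw0 z)]
    calc |deltaH H Ψ z| * |φ z| * Real.exp (-H z)
        ≤ |deltaH H Ψ z| * 1 * Real.exp (-H z) :=
          mul_le_mul_of_nonneg_right (mul_le_mul_of_nonneg_left (hφb z) (abs_nonneg _)) (hw0 z)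
      _ = |deltaH H Ψ z| * Real.exp (-H z) := by ring
  have hI1 : Integrable (fun z => deltaH H Ψ z * (if 0 < deltaH H Ψ z then (1 : ℝ) else 0)
      * Real.exp (-H z)) μ := by
    refine hdom _ hpos_m fun z => ?_
    split_ifs <;> simp
  have hI2 : Integrable (fun z => deltaH H Ψ z * ((if 0 < deltaH H Ψ z then (1 : ℝ) else 0)
      * Real.exp (-deltaH H Ψ z)) * Real.exp (-H z)) μ := by
    refine hdom _ (hpos_m.mul (Real.measurable_exp.comp hΔm.neg)) fun z => ?_
    split_ifs with h
    · have h1 : Real.exp (-deltaH H Ψ z) ≤ 1 := by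
        rw [← Real.exp_zero]; exact Real.exp_le_exp.mpr (by linarith)
      rw [one_mul, abs_of_pos (Real.exp_pos _)]
      exact h1
    · simp
  have hI3 : Integrable (fun z => deltaH H Ψ z * (if deltaH H Ψ z < 0 then (1 : ℝ) else 0)
      * Real.exp (-H z)) μ := by
    refine hdom _ hneg_m fun z => ?_
    split_ifs <;> simp
  -- the fluctuation relation with `g(x) = x 𝟙[x < 0]`: `∫ ΔH 𝟙[ΔH<0] e^{−H} = −∫ ΔH e^{−ΔH} 𝟙[ΔH>0] e^{−H}`
  have hrel := integral_comp_deltaH_eq (H := H) hΨm hΨi hΨμ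
    (fun x => x * (if x < 0 then (1 : ℝ) else 0))
  have hrel' : ∫ z, deltaH H Ψ z * (if deltaH H Ψ z < 0 then (1 : ℝ) else 0) * Real.exp (-H z) ∂μ
      = -∫ z, deltaH H Ψ z * ((if 0 < deltaH H Ψ z then (1 : ℝ) else 0) * Real.exp (-deltaH H Ψ z))
          * Real.exp (-H z) ∂μ := by
    rw [hrel, ← integral_neg]
    refine integral_congr_ae (Eventually.of_forall fun z => ?_)
    simp only [neg_lt_zero]
    ring
  have hsplit : ∀ z, deltaH H Ψ z * (1 + Real.exp (-deltaH H Ψ z)) * (if 0 < deltaH H Ψ z then (1 : ℝ) else 0)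
      * Real.exp (-H z)
      = deltaH H Ψ z * (if 0 < deltaH H Ψ z then (1 : ℝ) else 0) * Real.exp (-H z)
        + deltaH H Ψ z * ((if 0 < deltaH H Ψ z then (1 : ℝ) else 0) * Real.exp (-deltaH H Ψ z))
          * Real.exp (-H z) := fun z => by ring
  simp_rw [hsplit]
  rw [integral_add hI1 hI2, show (∫ z, deltaH H Ψ z * ((if 0 < deltaH H Ψ z then (1 : ℝ) else 0)
      * Real.exp (-deltaH H Ψ z)) * Real.exp (-H z) ∂μ)
      = -∫ z, deltaH H Ψ z * (if deltaH H Ψ z < 0 then (1 : ℝ) else 0) * Real.exp (-H z) ∂μ by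
        rw [hrel', neg_neg], ← sub_eq_add_neg, ← integral_sub hI1 hI3]
  refine integral_congr_ae (Eventually.of_forall fun z => ?_)
  dsimp only
  by_cases h : 0 < deltaH H Ψ z
  · rw [if_pos h, if_neg (not_lt.mpr h.le), abs_of_pos h]
    ring
  · by_cases h' : deltaH H Ψ z < 0
    · rw [if_neg h, if_pos h', abs_of_neg h']
      ring
    · have h0 : deltaH H Ψ z = 0 := le_antisymm (not_lt.mp h) (not_lt.mp h')
      rw [if_neg h, if_neg h', h0]
      simp

/-- **THE FERMI PENCIL**: `Ψ` a measurable `μ`-preserving involution, `e^{−H} ∈ L¹` with `Z > 0`, `ΔH e^{−H} ∈ L¹`,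
`ℓ = Z⁻¹∫|ΔH|e^{−H}`.  For every `a > 0`:  `(1 − (e^{2a} − 1 + 2e^{a}(ℓ − a))/(e^{a} + 1)²)·Z ≤ ∫ min(1, e^{−ΔH}) e^{−H}`
(the tangent of `tanh(·/2)` at `a`: `1 − A/Z ≤ tanh(a/2) + ½sech²(a/2)(ℓ − a)`). [ours] -/
theorem involutive_acceptance_ge_fermiPencil {H : X → ℝ} {Ψ : X → X} (hH : Measurable H)
    (hΨm : Measurable Ψ) (hΨi : Function.Involutive Ψ) (hΨμ : MeasurePreserving Ψ μ μ)
    (hw : Integrable (fun z => Real.exp (-H z)) μ)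
    (hΔ : Integrable (fun z => deltaH H Ψ z * Real.exp (-H z)) μ) (hZ : 0 < ∫ z, Real.exp (-H z) ∂μ)
    {a : ℝ} (ha : 0 < a) :
    (1 - (Real.exp (2 * a) - 1 + 2 * Real.exp a
        * ((∫ z, |deltaH H Ψ z| * Real.exp (-H z) ∂μ) / (∫ z, Real.exp (-H z) ∂μ) - a)) / (Real.exp a + 1) ^ 2)
        * ∫ z, Real.exp (-H z) ∂μ
      ≤ ∫ z, min 1 (Real.exp (-deltaH H Ψ z)) * Real.exp (-H z) ∂μ := by
  set Z := ∫ z, Real.exp (-H z) ∂μ with hZdef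
  set L := ∫ z, |deltaH H Ψ z| * Real.exp (-H z) ∂μ with hLdef
  set A := ∫ z, min 1 (Real.exp (-deltaH H Ψ z)) * Real.exp (-H z) ∂μ with hAdef
  set u := Real.exp a with hu
  have hΔm : Measurable (deltaH H Ψ) := measurable_deltaH hH hΨm
  have hwm : Measurable fun z => Real.exp (-H z) := Real.measurable_exp.comp hH.neg
  have hw0 : ∀ z, 0 ≤ Real.exp (-H z) := fun z => (Real.exp_pos _).le
  have hu0 : 0 < u := Real.exp_pos a
  have hc : 0 < (u + 1) ^ 2 := by positivity
  have hpos_m : Measurable fun z => (if 0 < deltaH H Ψ z then (1 : ℝ) else 0) :=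
    Measurable.ite (measurableSet_lt measurable_const hΔm) measurable_const measurable_const
  -- coefficient of `N` is non-negative: `u² − 1 − 2ua ≥ 0` (`sinh a ≥ a`)
  have hκ : 0 ≤ u * u - 1 - 2 * u * a := by
    have hua : Real.exp a * Real.exp (-a) = 1 := by rw [← Real.exp_add, add_neg_cancel, Real.exp_zero]
    have hp : 1 + a + a ^ 2 / 2 ≤ u := by rw [hu]; exact Real.quadratic_le_exp_of_nonneg ha.le
    -- `u(u − 2a) ≥ p(p − 2a) = 1 + a⁴/4 ≥ 1` with `p = 1 + a + a²/2 ≤ u`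
    have h3 : 0 ≤ (u - (1 + a + a ^ 2 / 2)) * (u + (1 + a + a ^ 2 / 2) - 2 * a) :=
      mul_nonneg (by linarith) (by nlinarith [hp, sq_nonneg a])
    nlinarith [h3, sq_nonneg (a ^ 2), sq_nonneg a]
  -- integrability
  have hIA : Integrable (fun z => min 1 (Real.exp (-deltaH H Ψ z)) * Real.exp (-H z)) μ := by
    refine integrable_bdd_mul_weight (measurable_const.min (Real.measurable_exp.comp hΔm.neg)) (C := 1)
      (fun z => ?_) hwm hw0 hw
    rw [abs_of_pos (lt_min one_pos (Real.exp_pos _))]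
    exact min_le_left _ _
  have hIG : Integrable (fun z => (1 + Real.exp (-deltaH H Ψ z)) * (if 0 < deltaH H Ψ z then (1 : ℝ) else 0)
      * Real.exp (-H z)) μ := by
    refine integrable_bdd_mul_weight (((measurable_const.add (Real.measurable_exp.comp hΔm.neg))).mul
      hpos_m) (C := 2) (fun z => ?_) hwm hw0 hw
    split_ifs with h
    · have h1 : Real.exp (-deltaH H Ψ z) ≤ 1 := by
        rw [← Real.exp_zero]; exact Real.exp_le_exp.mpr (by linarith)
      rw [mul_one, abs_of_pos (by positivity)]
      linarith
    · simp
  have hIK : Integrable (fun z => deltaH H Ψ z * (1 + Real.exp (-deltaH H Ψ z))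
      * (if 0 < deltaH H Ψ z then (1 : ℝ) else 0) * Real.exp (-H z)) μ := by
    refine Integrable.mono' (hΔ.norm.const_mul 2)
      ((((hΔm.mul (measurable_const.add (Real.measurable_exp.comp hΔm.neg))).mul hpos_m).mul
        hwm).aestronglyMeasurable) (Eventually.of_forall fun z => ?_)
    rw [Real.norm_eq_abs, Real.norm_eq_abs, abs_mul, abs_mul, abs_mul, abs_mul, abs_of_nonneg (hw0 z)]
    have hb : |1 + Real.exp (-deltaH H Ψ z)| * |(if 0 < deltaH H Ψ z then (1 : ℝ) else 0)| ≤ 2 := by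
      split_ifs with h
      · have h1 : Real.exp (-deltaH H Ψ z) ≤ 1 := by
          rw [← Real.exp_zero]; exact Real.exp_le_exp.mpr (by linarith)
        rw [abs_one, mul_one, abs_of_pos (by positivity)]
        linarith
      · simp
    calc |deltaH H Ψ z| * |1 + Real.exp (-deltaH H Ψ z)| * |(if 0 < deltaH H Ψ z then (1 : ℝ) else 0)|
          * Real.exp (-H z)
        = (|1 + Real.exp (-deltaH H Ψ z)| * |(if 0 < deltaH H Ψ z then (1 : ℝ) else 0)|)
            * (|deltaH H Ψ z| * Real.exp (-H z)) := by ring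
      _ ≤ 2 * (|deltaH H Ψ z| * Real.exp (-H z)) :=
          mul_le_mul_of_nonneg_right hb (mul_nonneg (abs_nonneg _) (hw0 z))
  -- integrate the certificate
  have hpt : ∀ z, (u + 1) ^ 2 * (Real.exp (-H z) - min 1 (Real.exp (-deltaH H Ψ z)) * Real.exp (-H z))
      ≤ (u * u - 1 - 2 * u * a) * ((1 + Real.exp (-deltaH H Ψ z)) * (if 0 < deltaH H Ψ z then (1 : ℝ) else 0)
          * Real.exp (-H z))
        + 2 * u * (deltaH H Ψ z * (1 + Real.exp (-deltaH H Ψ z))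
          * (if 0 < deltaH H Ψ z then (1 : ℝ) else 0) * Real.exp (-H z)) := by
    intro z
    have h := mul_le_mul_of_nonneg_right (one_sub_min_exp_neg_mul_fermi_le ha (deltaH H Ψ z)) (hw0 z)
    have hu2 : Real.exp (2 * a) = u * u := by rw [hu, ← Real.exp_add]; ring_nf
    rw [hu2] at h
    nlinarith [h]
  have hJ1 : Integrable (fun z => (u + 1) ^ 2
      * (Real.exp (-H z) - min 1 (Real.exp (-deltaH H Ψ z)) * Real.exp (-H z))) μ :=
    (hw.sub hIA).const_mul _
  have hJ2 : Integrable (fun z =>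
      (u * u - 1 - 2 * u * a) * ((1 + Real.exp (-deltaH H Ψ z)) * (if 0 < deltaH H Ψ z then (1 : ℝ) else 0)
          * Real.exp (-H z))
        + 2 * u * (deltaH H Ψ z * (1 + Real.exp (-deltaH H Ψ z))
          * (if 0 < deltaH H Ψ z then (1 : ℝ) else 0) * Real.exp (-H z))) μ :=
    (hIG.const_mul _).add (hIK.const_mul _)
  have hmono := integral_mono hJ1 hJ2 hpt
  rw [integral_const_mul, integral_sub hw hIA, integral_add (hIG.const_mul _) (hIK.const_mul _),
    integral_const_mul, integral_const_mul, integral_posPart_absMoment_eq hH hΨm hΨi hΨμ hΔ] at hmono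
  have hG := integral_posPart_weights_le hH hΨm hΨi hΨμ hw
  -- `(u+1)²(Z − A) ≤ (u² − 1 − 2ua)·Z + 2u·L`
  have key : (u + 1) ^ 2 * (Z - A) ≤ (u * u - 1 - 2 * u * a) * Z + 2 * u * L := by
    have h2 := mul_le_mul_of_nonneg_left hG hκ
    linarith
  have hu2 : Real.exp (2 * a) = u * u := by rw [hu, ← Real.exp_add]; ring_nf
  rw [hu2]
  have e : (1 - (u * u - 1 + 2 * u * (L / Z - a)) / (u + 1) ^ 2) * Z
      = Z - ((u * u - 1 - 2 * u * a) * Z + 2 * u * L) / (u + 1) ^ 2 := by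
    field_simp
    ring
  rw [e, sub_le_comm, le_div_iff₀ hc, mul_comm]
  exact key

/-- **THE FERMI-FUNCTION FLOOR**: under the same hypotheses with `ℓ = Z⁻¹∫|ΔH|e^{−H} > 0`,
`(2/(1 + e^{ℓ}))·Z ≤ ∫ min(1, e^{−ΔH}) e^{−H}` — the acceptance of every volume-preserving reversible proposal is at
least the Fermi function `1 − tanh(ℓ/2)` of its mean absolute energy violation (the pencil at `a = ℓ`). [ours] -/
theorem involutive_acceptance_ge_fermi {H : X → ℝ} {Ψ : X → X} (hH : Measurable H)
    (hΨm : Measurable Ψ) (hΨi : Function.Involutive Ψ) (hΨμ : MeasurePreserving Ψ μ μ)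
    (hw : Integrable (fun z => Real.exp (-H z)) μ)
    (hΔ : Integrable (fun z => deltaH H Ψ z * Real.exp (-H z)) μ) (hZ : 0 < ∫ z, Real.exp (-H z) ∂μ)
    (hℓ : 0 < (∫ z, |deltaH H Ψ z| * Real.exp (-H z) ∂μ) / ∫ z, Real.exp (-H z) ∂μ) :
    (2 / (1 + Real.exp ((∫ z, |deltaH H Ψ z| * Real.exp (-H z) ∂μ) / ∫ z, Real.exp (-H z) ∂μ)))
        * ∫ z, Real.exp (-H z) ∂μ
      ≤ ∫ z, min 1 (Real.exp (-deltaH H Ψ z)) * Real.exp (-H z) ∂μ := by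
  set ℓ := (∫ z, |deltaH H Ψ z| * Real.exp (-H z) ∂μ) / ∫ z, Real.exp (-H z) ∂μ with hℓdef
  have h := involutive_acceptance_ge_fermiPencil hH hΨm hΨi hΨμ hw hΔ hZ hℓ
  have hu0 : 0 < Real.exp ℓ := Real.exp_pos ℓ
  have e : 1 - (Real.exp (2 * ℓ) - 1 + 2 * Real.exp ℓ * (ℓ - ℓ)) / (Real.exp ℓ + 1) ^ 2
      = 2 / (1 + Real.exp ℓ) := by
    have hu2 : Real.exp (2 * ℓ) = Real.exp ℓ * Real.exp ℓ := by rw [← Real.exp_add]; ring_nf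
    rw [hu2, sub_self, mul_zero, add_zero]
    have hne : Real.exp ℓ + 1 ≠ 0 := by linarith
    have hne' : 1 + Real.exp ℓ ≠ 0 := by linarith
    field_simp
    ring
  rw [← e]
  exact h

end Involutive

/-! ## §3 Equality for the two-state flip -/

section TwoState

/-- **`∫ |ΔH| e^{−H} = a(1 + e^{−a})`** for the two-state flip with gap `a ≥ 0` (so `ℓ = a`). [ours] -/
theorem twoState_meanAbsViolation {a : ℝ} (ha : 0 ≤ a) :
    ∫ b, |deltaH (fun b : Bool => if b then a else 0) not b| * Real.exp (-(fun b : Bool => if b then a else 0) b)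
        ∂(Measure.dirac false + Measure.dirac true)
      = a * (1 + Real.exp (-a)) := by
  rw [integral_diracPair_bool, deltaH_twoState_false, deltaH_twoState_true]
  simp only [Bool.false_eq_true, ↓reduceIte, neg_zero, Real.exp_zero, mul_one, abs_neg, abs_of_nonneg ha]
  ring

/-- **THE TWO-STATE FLIP ATTAINS THE FERMI FLOOR**: for `a > 0`, `(2/(1 + e^{ℓ}))·Z = A` with `ℓ = Z⁻¹∫|ΔH|e^{−H} = a`,
`Z = 1 + e^{−a}`, `A = 2e^{−a}`. [ours] -/
theorem twoState_attains_fermi {a : ℝ} (ha : 0 < a) :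
    (2 / (1 + Real.exp ((∫ b, |deltaH (fun b : Bool => if b then a else 0) not b|
          * Real.exp (-(fun b : Bool => if b then a else 0) b) ∂(Measure.dirac false + Measure.dirac true))
        / ∫ b, Real.exp (-(fun b : Bool => if b then a else 0) b) ∂(Measure.dirac false + Measure.dirac true))))
      * ∫ b, Real.exp (-(fun b : Bool => if b then a else 0) b) ∂(Measure.dirac false + Measure.dirac true)
      = ∫ b, min 1 (Real.exp (-deltaH (fun b : Bool => if b then a else 0) not b))
          * Real.exp (-(fun b : Bool => if b then a else 0) b) ∂(Measure.dirac false + Measure.dirac true) := by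
  rw [twoState_meanAbsViolation ha.le, twoState_partition, twoState_acceptance ha.le]
  have hv : 0 < Real.exp (-a) := Real.exp_pos _
  have hZ : 1 + Real.exp (-a) ≠ 0 := by linarith
  rw [mul_div_assoc, div_self hZ, mul_one]
  have hua : Real.exp a * Real.exp (-a) = 1 := by rw [← Real.exp_add, add_neg_cancel, Real.exp_zero]
  have hne : 1 + Real.exp a ≠ 0 := by linarith [Real.exp_pos a]
  field_simp
  nlinarith [hua]

end TwoState

end Summit.Ventures.LatticeQCDFlow.Exactness
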